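import Literature.Computability.Cryptography.PRGStretchExtensionReduction
import Literature.Computability.Cryptography.GGMProofs
import Literature.Computability.Cryptography.PseudorandomFunctionsPneNPProofs
import Literature.Computability.Cryptography.PseudorandomGeneratorsStretchOne
import HarnessLib

/-!
# Discharge of crypto-foundations.S09 `PRFExist_of_PRGExist` (Goldreich–Goldwasser–Micali) and the printed corollaries

Topic `Literature/Computability/Cryptography`; a thin assembly layer over three files already in the
tree, introducing NO named facts:

* `PRGStretchExtensionReduction.lean` proves `PRFExist_of_PRGExist_of_GGM : GGM1986_thm3 → PRFExist_of_PRGExist`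
  (Goldreich 2001, Construction 3.3.2 / Thm. 3.3.3 discharged there as `exists_isPRG_of_stretch_succ_holds`,
  composed with Construction 3.6.5);
* `GGMProofs.lean` proves the GGM Main Theorem `GGM1986_thm3_holds` (GGM 1986, Thm. 3 = Goldreich 2001,
  Thm. 3.6.6: the tree ensemble over a length-doubling pseudorandom generator is a pseudorandom function
  ensemble);
* `PseudorandomFunctionsPneNPProofs.lean` proves the converse `PRGExist_of_PRFExist_holds` (Goldreich 2001,
  Cor. 3.6.8 `⇒`, Exercise 28.1).

Hence the named fact **`PRFExist_of_PRGExist`** (`Pseudorandomness.lean`, crypto-foundations.S09: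
"if pseudorandom generators exist then pseudorandom functions exist", GGM 1986, Thm. 3; Goldreich 2001,
Thm. 3.6.6) is now a theorem, `PRFExist_of_PRGExist_holds`, and Goldreich's Corollary 3.6.8 as printed
("pseudorandom functions exist if and only if pseudorandom generators exist") holds outright,
`PRFExist_iff_PRGExist`. Corollary 3.6.7 ("if one-way functions exist then pseudorandom functions exist")
is recorded modulo the single remaining named fact on that line, HILL (`PRGExist_iff_OWFExist`,
crypto-foundations.S07), as `PRFExist_of_OWFExist_of_HILL` / `PRFExist_iff_OWFExist_of_HILL`.

## References

* O. Goldreich, S. Goldwasser, S. Micali, *How to construct random functions*, J. ACM 33 (1986), Thm. 3.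
* O. Goldreich, *Foundations of Cryptography I: Basic Tools*, CUP 2001, §3.3.2 (Thm. 3.3.3), §3.6.2
  (Construction 3.6.5, Thm. 3.6.6), Cor. 3.6.7, Cor. 3.6.8.
* J. Håstad, R. Impagliazzo, L. Levin, M. Luby, *A pseudorandom generator from any one-way function*,
  SIAM J. Comput. 28 (1999), Thm. 1.1 (the remaining named fact `PRGExist_iff_OWFExist`).
-/

namespace Literature.Computability.Cryptography

/-- **Discharge of crypto-foundations.S09 `PRFExist_of_PRGExist`** (GGM 1986, Thm. 3; Goldreich 2001,
Thm. 3.6.6 with Thm. 3.3.3): pseudorandom generators yield (length-preserving) pseudorandom function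
ensembles — the GGM Main Theorem `GGM1986_thm3_holds` fed into `PRFExist_of_PRGExist_of_GGM`.
[cite: GoldreichGoldwasserMicali1986, Thm. 3] -/
theorem PRFExist_of_PRGExist_holds : PRFExist_of_PRGExist :=
  PRFExist_of_PRGExist_of_GGM GGM1986_thm3_holds

/-- **Goldreich's Corollary 3.6.8 as printed, now unconditional** (length-preserving case):
"pseudorandom functions exist if and only if pseudorandom generators exist" — `⇐` is GGM
(`PRFExist_of_PRGExist_holds`), `⇒` is Exercise 28.1 (`PRGExist_of_PRFExist_holds`).
[cite: Goldreich2001, Cor. 3.6.8] -/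
theorem PRFExist_iff_PRGExist : PRFExist ↔ PRGExist :=
  PRFExist_iff_PRGExist_of PRGExist_of_PRFExist_holds PRFExist_of_PRGExist_holds

/-- **Goldreich's Corollary 3.6.7 modulo HILL only**: "if there exist one-way functions, then pseudorandom
functions exist as well" — with GGM discharged, the one named fact left on this line is
`PRGExist_iff_OWFExist` (HILL 1999, Thm. 1.1 = Goldreich 2001, Thm. 3.5.12 with Prop. 3.3.8).
[cite: Goldreich2001, Cor. 3.6.7] -/
theorem PRFExist_of_OWFExist_of_HILL (hHILL : PRGExist_iff_OWFExist) (howf : OWFExist) : PRFExist :=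
  PRFExist_of_OWFExist_of PRFExist_of_PRGExist_holds hHILL howf

/-- **`PRFExist ↔ OWFExist` modulo HILL only** (Goldreich 2001, Cor. 3.6.7 and Cor. 3.6.8 with Thm. 3.5.12):
both GGM (`PRFExist_of_PRGExist_holds`) and Exercise 28.1 (`PRGExist_of_PRFExist_holds`) are theorems,
so the equivalence rests on the single named fact `PRGExist_iff_OWFExist`.
[cite: Goldreich2001, Cor. 3.6.7 and Cor. 3.6.8 with Thm. 3.5.12] -/
theorem PRFExist_iff_OWFExist_of_HILL (hHILL : PRGExist_iff_OWFExist) : PRFExist ↔ OWFExist :=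
  PRFExist_iff_OWFExist_of PRGExist_of_PRFExist_holds PRFExist_of_PRGExist_holds hHILL

/-- **Pseudorandom functions yield one-way functions, unconditionally**: `PRFExist → OWFExist`, by
Exercise 28.1 (`PRGExist_of_PRFExist_holds`) and Prop. 3.3.8 (a pseudorandom generator is one-way,
the elementary direction `OWFExist_of_PRGExist` of `PRGExist_iff_OWFExist`, proved in the tree).
[cite: Goldreich2001, Cor. 3.6.8 and §3.3.6 Prop. 3.3.8] -/
theorem OWFExist_of_PRFExist (hF : PRFExist) : OWFExist :=
  OWFExist_of_PRGExist (PRGExist_of_PRFExist_holds hF)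

end Literature.Computability.Cryptography
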